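import Mathlib.Analysis.Complex.UpperHalfPlane.Exp
import Mathlib.Analysis.SpecialFunctions.Complex.Log
import Mathlib.Analysis.SpecialFunctions.Pow.Complex
import Mathlib.Analysis.SpecialFunctions.Pow.Real
import Mathlib.GroupTheory.QuotientGroup.Basic
import Literature.AnabelianGeometry.EtaleTheta.ClassicalTheta
import HarnessLib

/-!
# [J-III] §12.4 `E_τ = ℂ/[1, τ]` and §12.7 Schottky parameters (typed, all PROVED; file 2 of slot T-35)

Block E of the abc-iut cell (rung LADDER-ABC:A2.E), seat abc-iut-E-t35, slot T-35 ([J-III] §12.1–12.8, class P4 «Geo»), file 2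
of 3: the part of the slot that needs only Mathlib — §12.4 "`E_τ` given by `[1, τ]`", Lem. 12.7.1, Def. 12.7.2 (with the
Schottky uniformization), Lem. 12.7.3 — plus the [EtTh] identity behind our reading of Thm. 12.8.5 (4). File 1 =
`Joshi/GeometricCase1.lean` (p431104: `CoverSL2R`, `φ_∞`, log-links, `Level`, `alpha`, `tauPt`, `ThetaGauLink`); file 3 =
`Joshi/GeometricCase1Theta.lean` (Thm. 12.8.5 (2)–(4), Rmk. 12.8.6, log-shifts and non-vacuity of Θgau-links; imports both).
Node ids J3:Lem12.7.1, J3:Def12.7.2, J3:Lem12.7.3 of plan/E/JOSHI-DAG.tsv (+ §12.4 `E_τ`). SOURCE: K. Joshi,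
arXiv:2401.13508**v4** (unrefereed; bib `Joshi2024ATS3`), §12.4, §12.7, PDF pp. 147–149; locators «p.N l.a–b» = PDF page /
lines of `HOME/lit/renders/Joshi-arxiv-2401.13508/pNNNN.txt`. Tree import: `Literature.AnabelianGeometry.EtaleTheta.ClassicalTheta`
(Mochizuki's series `Θ̈`, [EtTh] Prop. 1.4, bib `MochizukiEtTh2009`); OUR frozen `Cor312*`/`Thm311*` files are NOT imported
(E-PLAN R14).

FRAMING (binding): TYPES a third party's unrefereed text for block E's test against
`S = Summit.ABC.IUTFork.Cor312Vol.PilotKummerIndRelated`; NO side taken on [IUTchIII] Cor. 3.12, on Joshi's claims, or on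
Mochizuki's report; typed ≠ proved; typed AS A CANDIDATE ≠ endorsed; nothing here bears on abc. Everything in this file is
settled complex analysis and is PROVED over Mathlib: Lem. 12.7.1 (isogeny `E_1 ~ E_{τ,α}`, by the lattice criterion
`IsIsogenousLattice` [folklore] — exactly what print's proof exhibits), Def. 12.7.2 with the Schottky uniformization
`E_τ ≃ ℂ*/q^ℤ` ("This is standard" — `schottkyUniformization`, via `z ↦ e^{2π√−1z}`, kernel `[1, τ]`), Lem. 12.7.3; no
`@[claim]`-tagged hypothesis occurs.

FAITHFULNESS FLAG (E-ref lane, not adjudicated): (F-a) Lem. 12.7.3 writes `q_{E_{τ,α}} = q_{E_1}^α` for rational `α`; print's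
"elementary calculation" (p.149 l.28–30) `e^{2π√−1(α·τ)} = (e^{2π√−1τ})^α` fixes the determination `q^α := exp(α · 2π√−1τ)`,
which is what `schottky_smul` types; with the PRINCIPAL branch of the complex power the identity is false whenever
`Re τ ∉ (−1/2, 1/2]` — PROVED instance `schottky_half_ne_cpow_half` (`τ = 1 + i`, `α = 1/2`: a sign). For INTEGER exponents the
identity is exact (`schottky_smul_natCast`). OUR-SIDE ANALOGUES (docstrings only; nothing bound): `q_E` ↔ the `q`-parameter
behind `Cor312.Setting.qPilot`; [EtTh]'s Tate parameter `q_X = q̈²`. No instance, notation, axiom or `sorry`; standard axioms.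
-/

noncomputable section

open Complex UpperHalfPlane
open scoped UpperHalfPlane Real

namespace Summit.ABC.IUTFork.Joshi.ATS3.Geo

/-! ## §12.4 `E_τ = ℂ/[1, τ]` (J3:§12.4) -/


/-- **[J-III] §12.4** (p.147 l.15): "If `τ ∈ ℍ`, I will write `E_τ` for the elliptic curve given by the lattice
`[1, τ] ⊂ ℂ`" — the lattice `Λ_τ = [1, τ] = ℤ + ℤτ` (Lem. 12.7.1: `Λ_{τ,1} = [1, τ]`, `Λ_{τ,α} = [1, α·τ]`), for any
`τ ∈ ℂ`. No algebraic elliptic-curve structure is read in §12; `E_τ` is the complex torus `torus τ`. -/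
def lattice (τ : ℂ) : AddSubgroup ℂ := AddSubgroup.closure {1, τ}

/-- `x ∈ [1, τ]` iff `x = m + n·τ` with `m, n ∈ ℤ`. -/
theorem mem_lattice_iff {τ x : ℂ} : x ∈ lattice τ ↔ ∃ m n : ℤ, (m : ℂ) + n * τ = x := by
  simp [lattice, AddSubgroup.mem_closure_pair, zsmul_eq_mul]

/-- `E_τ := ℂ/[1, τ]` as a complex torus (additive quotient group; p.147 l.15, p.148 l.32–33 "`E_1 = ℂ/Λ_1`"). -/
abbrev torus (τ : ℂ) : Type := ℂ ⧸ lattice τ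

/-! ## §12.7 The Schottky parameter (J3:Lem12.7.1, Def12.7.2, Lem12.7.3) -/

/-- "`ℂ`-isogenous" for complex tori `ℂ/Λ₁`, `ℂ/Λ₂` (Lem. 12.7.1): typed by the lattice criterion — there is `c ∈ ℂ*`
with `c·Λ₁ ⊆ Λ₂` (every holomorphic homomorphism `ℂ/Λ₁ → ℂ/Λ₂` is `z ↦ cz`; for full lattices `cΛ₁ ⊆ Λ₂` has finite
index automatically). Print's proof (p.149 l.1–18) exhibits exactly such a matrix/scalar (e.g. Silverman,
*The Arithmetic of Elliptic Curves*, VI Thm. 4.1). [folklore] -/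
@[folklore]
def IsIsogenousLattice (Λ₁ Λ₂ : AddSubgroup ℂ) : Prop := ∃ c : ℂ, c ≠ 0 ∧ ∀ x ∈ Λ₁, c * x ∈ Λ₂

/-- The homomorphism of tori `ℂ/Λ₁ → ℂ/Λ₂`, `z ↦ c·z`, induced by a witness `cΛ₁ ⊆ Λ₂` of `IsIsogenousLattice`
(the isogeny itself, as a group homomorphism). [folklore] -/
def isogenyOfWitness {Λ₁ Λ₂ : AddSubgroup ℂ} (c : ℂ) (hc : ∀ x ∈ Λ₁, c * x ∈ Λ₂) : ℂ ⧸ Λ₁ →+ ℂ ⧸ Λ₂ :=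
  QuotientAddGroup.map Λ₁ Λ₂ (AddMonoidHom.mulLeft c) fun x hx => by simpa using hc x hx

/-- **[J-III] Lem. 12.7.1** (p.148 l.32 – p.149 l.18): "Let `τ ∈ ℍ`. For any `α ∈ ℚ_{>0}`, the elliptic curves
`E_1 = ℂ/Λ_1` and `E_{τ,α} = ℂ/Λ_{τ,α}` given by the lattices `Λ_{τ,1} = [1, τ] ⊂ ℂ` and `Λ_{τ,α} = [1, α·τ]` are
`ℂ`-isogenous. Proof. … `diag(1, α) ∈ GL₂⁺(ℚ)` … takes `Λ_1` to `Λ_α`." PROVED (for every `τ ∈ ℂ`): with `α = p/q` in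
lowest terms, `p·[1, τ] = [p, q·(ατ)] ⊆ [1, ατ]`. -/
theorem isIsogenousLattice_smul (τ : ℂ) {α : ℚ} (hα : 0 < α) :
    IsIsogenousLattice (lattice τ) (lattice ((α : ℂ) * τ)) := by
  refine ⟨(α.num : ℂ), by exact_mod_cast (Rat.num_pos.mpr hα).ne', fun x hx => ?_⟩
  obtain ⟨m, n, rfl⟩ := mem_lattice_iff.mp hx
  have hnum : (α : ℂ) * (α.den : ℂ) = (α.num : ℂ) := by
    have h := congrArg (fun q : ℚ => (q : ℂ)) (Rat.mul_den_eq_num α)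
    push_cast at h
    exact h
  refine mem_lattice_iff.mpr ⟨m * α.num, n * α.den, ?_⟩
  push_cast
  rw [← hnum]; ring

/-- **[J-III] Def. 12.7.2** (p.149 l.19–20): "For an elliptic curve `E` given by a lattice `[1, τ] ⊂ ℂ` let
`q_E = e^{2π·√−1τ}` be its Schottky parameter." Our-side analogue (not bound): the `q`-parameter behind
`Cor312.Setting.qPilot`; [EtTh]'s Tate parameter `q_X`. -/
def schottky (τ : ℍ) : ℂ := cexp (2 * π * Complex.I * τ)

/-- `q_E ≠ 0`. -/
theorem schottky_ne_zero (τ : ℍ) : schottky τ ≠ 0 := Complex.exp_ne_zero _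

/-- `|q_E| < 1` for `τ ∈ ℍ`. -/
theorem norm_schottky_lt_one (τ : ℍ) : ‖schottky τ‖ < 1 := by
  unfold schottky; exact UpperHalfPlane.norm_exp_two_pi_I_lt_one τ

/-- `q_E` as a unit of `ℂ`. -/
def schottkyUnit (τ : ℍ) : ℂˣ := Units.mk0 (schottky τ) (schottky_ne_zero τ)

/-- `z ↦ e^{2π√−1 z} ∈ ℂ*` (the exponential uniformizing `ℂ/ℤ ≅ ℂ*`). [folklore] -/
def expUnit (z : ℂ) : ℂˣ := Units.mk0 (cexp (2 * π * Complex.I * z)) (Complex.exp_ne_zero _)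

/-- `e^{2π√−1(a+b)} = e^{2π√−1a} e^{2π√−1b}`. -/
theorem expUnit_add (a b : ℂ) : expUnit (a + b) = expUnit a * expUnit b := by
  ext; simp [expUnit, mul_add, Complex.exp_add]

/-- Every `u ∈ ℂ*` is `e^{2π√−1z}` (take `z = log u / 2π√−1`). -/
theorem expUnit_surjective : Function.Surjective expUnit := fun u =>
  ⟨Complex.log u / (2 * π * Complex.I), by
    ext
    simp only [expUnit, Units.val_mk0]
    rw [mul_div_cancel₀ _ Complex.two_pi_I_ne_zero, Complex.exp_log u.ne_zero]⟩

/-- `z ↦ e^{2π√−1 z}` as a homomorphism `(ℂ, +) → ℂ*`. [folklore] -/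
def expUnitHom : ℂ →+ Additive ℂˣ where
  toFun z := Additive.ofMul (expUnit z)
  map_zero' := by
    rw [ofMul_eq_zero]; ext; simp [expUnit]
  map_add' a b := by rw [expUnit_add, ofMul_mul]

/-- `q_E^ℤ ⊂ ℂ*`, written additively (`Additive ℂˣ` is `ℂ*` with `+` for `·`): the periods of the Schottky
uniformization. [folklore] -/
def schottkyPeriods (τ : ℍ) : AddSubgroup (Additive ℂˣ) := AddSubgroup.zmultiples (Additive.ofMul (schottkyUnit τ))

/-- The Schottky uniformization map `ℂ → ℂ*/q_E^ℤ`, `z ↦ e^{2π√−1z} mod q_E^ℤ` (target written additively). [folklore] -/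
def schottkyHom (τ : ℍ) : ℂ →+ Additive ℂˣ ⧸ schottkyPeriods τ :=
  (QuotientAddGroup.mk' (schottkyPeriods τ)).comp expUnitHom

/-- Unfolding `schottkyHom`. -/
theorem schottkyHom_apply (τ : ℍ) (z : ℂ) :
    schottkyHom τ z = ((Additive.ofMul (expUnit z) : Additive ℂˣ) : Additive ℂˣ ⧸ schottkyPeriods τ) :=
  rfl

/-- `ℂ → ℂ*/q_E^ℤ` is onto. -/
theorem schottkyHom_surjective (τ : ℍ) : Function.Surjective (schottkyHom τ) := fun x => by
  obtain ⟨u, rfl⟩ := QuotientAddGroup.mk_surjective x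
  obtain ⟨z, hz⟩ := expUnit_surjective (Additive.toMul u)
  exact ⟨z, by rw [schottkyHom_apply, hz, ofMul_toMul]⟩

/-- The kernel of `ℂ → ℂ*/q_E^ℤ` is exactly the lattice `[1, τ]`: `e^{2π√−1z} ∈ q^ℤ ⟺ z ∈ ℤ + ℤτ`. -/
theorem mem_ker_schottkyHom_iff (τ : ℍ) (z : ℂ) : z ∈ (schottkyHom τ).ker ↔ z ∈ lattice τ := by
  rw [AddMonoidHom.mem_ker, schottkyHom_apply, QuotientAddGroup.eq_zero_iff, schottkyPeriods,
    AddSubgroup.mem_zmultiples_iff, mem_lattice_iff]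
  constructor
  · rintro ⟨k, hk⟩
    rw [← ofMul_zpow, Additive.ofMul.injective.eq_iff] at hk
    have hk' : cexp (k * (2 * π * Complex.I * τ)) = cexp (2 * π * Complex.I * z) := by
      have h := congrArg Units.val hk
      rwa [Units.val_zpow_eq_zpow_val, schottkyUnit, expUnit, Units.val_mk0, Units.val_mk0, schottky,
        ← Complex.exp_int_mul] at h
    obtain ⟨n, hn⟩ := Complex.exp_eq_exp_iff_exists_int.mp hk'
    have h3 : ((k : ℂ) * τ - z - n) * (2 * π * Complex.I) = 0 := by linear_combination hn
    have h4 : (k : ℂ) * τ - z - n = 0 := (mul_eq_zero.mp h3).resolve_right Complex.two_pi_I_ne_zero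
    refine ⟨-n, k, ?_⟩
    push_cast
    linear_combination h4
  · rintro ⟨m, n, rfl⟩
    refine ⟨n, ?_⟩
    rw [← ofMul_zpow, Additive.ofMul.injective.eq_iff]
    ext
    rw [Units.val_zpow_eq_zpow_val, schottkyUnit, expUnit, Units.val_mk0, Units.val_mk0, schottky,
      ← Complex.exp_int_mul]
    exact Complex.exp_eq_exp_iff_exists_int.mpr ⟨-m, by push_cast; ring⟩

/-- The kernel of the Schottky map is `[1, τ]`. -/
theorem ker_schottkyHom (τ : ℍ) : (schottkyHom τ).ker = lattice τ :=
  AddSubgroup.ext (mem_ker_schottkyHom_iff τ)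

/-- **[J-III] Def. 12.7.2, second sentence** (p.149 l.20–23): "Then one has the Schottky uniformization `E ≃ ℂ*/q_E^ℤ`.
Proof. This is standard." PROVED: `E_τ = ℂ/[1, τ] ≃ ℂ*/q_E^ℤ` as groups, induced by `z ↦ e^{2π√−1z}`. [folklore] -/
def schottkyUniformization (τ : ℍ) : torus (τ : ℂ) ≃+ Additive ℂˣ ⧸ schottkyPeriods τ :=
  (QuotientAddGroup.quotientAddEquivOfEq (ker_schottkyHom τ).symm).trans
    (QuotientAddGroup.quotientKerEquivOfSurjective (schottkyHom τ) (schottkyHom_surjective τ))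

/-- **[J-III] Lem. 12.7.3** (p.149 l.24–30): "For the elliptic curves `E_1` and `E_{τ,α}` one has the following
relationship between their Schottky parameters: `q_{E_{τ,α}} = q_{E_1}^α`. Proof. This is an elementary calculation:
`q_{E_{τ,α}} = e^{2π·√−1(α·τ)} = e^{2π·√−1·α·τ} = q_{E_1}^α`." PROVED in the determination print's calculation fixes,
`q^α := exp(α · 2π√−1τ)` — flag (F-a). Stated for every positive real `α` (print: `α ∈ ℚ_{>0}`), `α·τ` being Mathlib's
action of the positive reals on `ℍ` (= file 1's `scale α _ τ` by definition). -/
theorem schottky_smul (a : {x : ℝ // 0 < x}) (τ : ℍ) :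
    schottky (a • τ) = cexp (((a : ℝ) : ℂ) * (2 * π * Complex.I * τ)) := by
  rw [schottky, UpperHalfPlane.coe_pos_real_smul, Complex.real_smul]; ring_nf

/-- Lem. 12.7.3 for an INTEGER exponent is exact: `q_{E_{τ,n}} = q_{E_1}^n` (`n ≥ 1`). -/
theorem schottky_smul_natCast (n : ℕ) (hn : 0 < (n : ℝ)) (τ : ℍ) :
    schottky ((⟨n, hn⟩ : {x : ℝ // 0 < x}) • τ) = schottky τ ^ n := by
  rw [schottky_smul, schottky, Complex.ofReal_natCast, Complex.exp_nat_mul]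

/-- `1 + √−1 ∈ ℍ` (the test point of flag (F-a)). -/
def onePlusI : ℍ := ⟨1 + Complex.I, by simp⟩

/-- **Flag (F-a) made precise (DERIVED, for the referee lane):** reading `q^α` in Lem. 12.7.3 with the PRINCIPAL branch
of the complex power, the lemma is FALSE — at `τ = 1 + √−1`, `α = 1/2`: `q_{E_{τ,1/2}} = e^{π√−1}e^{−π} = −e^{−π}` while
`q_{E_1}^{1/2} = (e^{−2π})^{1/2} = e^{−π}`. Hence the determination `q^α := exp(α·2π√−1τ)` of print's calculation
(`schottky_smul`) is the reading under which Lem. 12.7.3 holds; nothing in §12 depends on the branch. -/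
theorem schottky_half_ne_cpow_half :
    schottky ((⟨1 / 2, one_half_pos⟩ : {x : ℝ // 0 < x}) • onePlusI) ≠ schottky onePlusI ^ ((1 / 2 : ℝ) : ℂ) := by
  have hτ : ((onePlusI : ℍ) : ℂ) = 1 + Complex.I := rfl
  have hq : schottky onePlusI = (Real.exp (-(2 * π)) : ℂ) := by
    rw [schottky, hτ, show 2 * (π : ℂ) * Complex.I * (1 + Complex.I) = ((-(2 * π) : ℝ) : ℂ) + 2 * π * Complex.I by
      push_cast; linear_combination (2 * (π : ℂ)) * Complex.I_sq, Complex.exp_add, Complex.exp_two_pi_mul_I, mul_one,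
      Complex.ofReal_exp]
  have hl : schottky ((⟨1 / 2, one_half_pos⟩ : {x : ℝ // 0 < x}) • onePlusI) = -(Real.exp (-π) : ℂ) := by
    rw [schottky_smul, hτ, show (((1 / 2 : ℝ)) : ℂ) * (2 * π * Complex.I * (1 + Complex.I)) =
        ((-π : ℝ) : ℂ) + π * Complex.I by push_cast; linear_combination ((π : ℂ)) * Complex.I_sq,
      Complex.exp_add, Complex.exp_pi_mul_I, mul_neg, mul_one, Complex.ofReal_exp]
  rw [hl, hq, ← Complex.ofReal_cpow (Real.exp_pos _).le, ← Real.exp_mul,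
    show -(2 * π) * (1 / 2 : ℝ) = -π by ring]
  intro h
  have h' := congrArg Complex.re h
  simp only [Complex.neg_re, Complex.ofReal_re] at h'
  linarith [Real.exp_pos (-π)]

/-! ## The [EtTh] Prop. 1.4 (ii) identity behind OUR READING of Thm. 12.8.5 (4) (used in file 3) -/

open Literature.AnabelianGeometry.EtaleTheta in
/-- For Mochizuki's series `Θ̈` of [EtTh] Prop. 1.4 (tree: `Literature.AnabelianGeometry.EtaleTheta.thetaDdot q̈ Ü`, Tate
parameter `q_X = q̈²`) and any `q̈ ≠ 0`, `a ∈ ℕ`: `Θ̈(q̈^a·√−1) = (q̈^{a²})^{−1}·Θ̈(√−1)` — [EtTh] Prop. 1.4 (ii)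
(`thetaDdot_zpow_mul`) at `Ü = √−1`, where the signs `(−1)^a · (√−1)^{−2a} = 1` cancel. DERIVED from the tree theorem;
file 3 specialises `q̈ := e^{2π√−1τ/2ℓ}` to read Thm. 12.8.5 (4) (`q̈^{j²} = q_{τ,j}`). [cite: MochizukiEtTh2009, Prop 1.4 (ii) p.22] -/
theorem thetaDdot_pow_mul_I {q2 : ℂ} (hq : q2 ≠ 0) (a : ℕ) :
    thetaDdot q2 (q2 ^ (a : ℤ) * Complex.I) = (q2 ^ (a ^ 2))⁻¹ * thetaDdot q2 Complex.I := by
  rw [thetaDdot_zpow_mul hq Complex.I_ne_zero]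
  have hε : (((a : ℤ).negOnePow : ℤ) : ℂ) = (-1 : ℂ) ^ a := by
    rw [Int.cast_negOnePow, zpow_natCast]
  have hI : Complex.I ^ (-(2 * (a : ℤ))) = (-1 : ℂ) ^ a := by
    rw [zpow_neg, zpow_mul, zpow_ofNat, Complex.I_sq, ← inv_zpow, inv_neg_one, zpow_natCast]
  have hq' : q2 ^ (-((a : ℤ) * (a : ℤ))) = (q2 ^ (a ^ 2))⁻¹ := by
    rw [zpow_neg, ← Nat.cast_mul, zpow_natCast, sq]
  have h1 : ((-1 : ℂ) ^ a) * ((-1 : ℂ) ^ a) = 1 := by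
    rw [← pow_add, ← two_mul, pow_mul, neg_one_sq, one_pow]
  rw [hε, hI, hq']
  linear_combination ((q2 ^ (a ^ 2))⁻¹ * thetaDdot q2 Complex.I) * h1

end Summit.ABC.IUTFork.Joshi.ATS3.Geo

end
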